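import Literature.Probability.LatticeModels.SixVertexGFF

/-!
# Six-vertex model: the column transfer matrix and the torus partition functions as traces
# (DKLM 2026, Part III §1 "Transfer matrix formalism", Lemma 55 / Corollary 56)

H. Duminil-Copin, K. K. Kozlowski, P. Lammers, I. Manolescu, *Gaussian free field convergence of
the six-vertex model with `-1 ≤ Δ ≤ -1/2`*, arXiv:2603.06268 (2026) [DKLM2026SixVertexGFF],
Part III §1, read in the held source (`paper:arxiv-2603.06268`, chunk p0040):

> A *column configuration* is an element `κ ∈ {±1}^{ℤ/Lℤ}` encoding arrow orientations in a
> column `E_i` of horizontal arrows […]. Write `𝔆` for the set of *balanced* column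
> configurations. Similarly, the *vertical column configuration* […] is an element
> `α^k ∈ {±1}^{ℤ/Lℤ}` encoding orientations of vertical arrows. […]
> **Corollary 56.** (1) *One-step partition function.* The operator `t(π/2)` […] satisfies
> `e_{κ'}† t(π/2) e_κ = ∑_{α} 𝟙{ice rule for (κ, α, κ')} · c^{#{c-vertices in (κ, α, κ')}}`.
> (3) *Torus measure.* `Z_{𝕋_{M,L}} ℙ_{𝕋_{M,L}}[{balanced}] 𝔼_{𝕋_{M,L}}[X | {balanced}] =
> Trace 𝔬_X^{0M}`.

This file sets up the transfer-matrix formalism for the torus weights of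
`Literature/Probability/LatticeModels/SixVertexGFF.lean` (general symmetric weights `a, b, c`)
and proves Corollary 56 (3) for the trivial observable `X = 1`, i.e. **the balanced torus
partition function is the trace of the `M`-th power of the balanced transfer matrix**
(`sum_torusWeight_filter_isBalanced_eq_trace`), together with its unrestricted analogue
(`sum_torusWeight_eq_trace`). The key combinatorial input is the classical path expansion of
the entries of a product of matrices (`listProd_ofFn_apply_eq_sum_paths`, inhomogeneous, hence
reusable for observables inserted in a strip of columns) and the resulting **cyclic trace
formula** `Trace (T₀ ⋯ T_m) = ∑_{p : ℤ/(m+1) → S} ∏_k T_k(p_k, p_{k+1})`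
(`trace_listProd_ofFn_eq_sum_cyclic`, `trace_pow_eq_sum_cyclic`).

## Contents

* `localWeight a b c E W N S` — the vertex weight as a function of its four incident arrows;
  `vertexWeight_eq_localWeight`.
* `columnWeight a b c κ κ' α` — weight of one column with west horizontal arrows `κ`, east
  horizontal arrows `κ'` and vertical arrows `α`; `torusWeight_eq_prod_columnWeight`.
* `transferMatrix a b c` (`= t(π/2)` of Cor. 56 (1) at `a = b = 1`), `IsBalancedCol`,
  `balancedTransferMatrix a b c` (its restriction to balanced column configurations `𝔆`).
* `listProd_ofFn_apply_eq_sum_paths`, `trace_listProd_ofFn_eq_sum_cyclic`,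
  `trace_pow_eq_sum_cyclic` — path expansions (any commutative semiring).
* `sum_torusWeight_eq_trace`, `sum_torusWeight_filter_isBalanced_eq_trace` — Cor. 56 (3),
  `X = 1`, on the torus `ZMod (m+1) × G₂`.

## References

* H. Duminil-Copin, K. K. Kozlowski, P. Lammers, I. Manolescu, arXiv:2603.06268 (2026),
  Part III §1, Lemma 55, Corollary 56. [DKLM2026SixVertexGFF]
* R. J. Baxter, *Exactly solved models in statistical mechanics* (1982), §8.3 (transfer matrix
  of the six-vertex model).
-/

noncomputable section

open Finset Matrix

namespace Literature.Probability.LatticeModels.SixVertex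

/-! ### The vertex weight as a function of the four incident arrows -/

/-- The local Boltzmann weight as a function of the four arrows at a vertex: `E` = the east edge
points east, `W` = the west edge points east, `N` = the north edge points north, `S` = the south
edge points north (so the in-degree is `[¬E] + [W] + [¬N] + [S]`): `0` off the ice rule, `a`/`b`
when the horizontal arrows are parallel and the east/north orientations agree/disagree, `c` when
the horizontal arrows are opposite. [cite: DKLM2026SixVertexGFF, Def. 2.1] -/
def localWeight (a b c : ℝ) (E W N S : Bool) : ℝ :=
  if (if E = true then 0 else 1) + (if W = true then 1 else 0) + (if N = true then 0 else 1) +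
        (if S = true then 1 else 0) = 2 then
    (if W = E then (if E = N then a else b) else c)
  else 0

/-- `vertexWeight` reads the four incident arrows through `localWeight`. [cite: DKLM2026SixVertexGFF, Def. 2.1] -/
theorem vertexWeight_eq_localWeight {G₁ G₂ : Type*} [AddGroup G₁] [AddGroup G₂] [One G₁] [One G₂]
    (a b c : ℝ) (ω : Config (G₁ × G₂)) (v : G₁ × G₂) :
    vertexWeight a b c ω v =
      localWeight a b c (ω v).1 (ω (v.1 - 1, v.2)).1 (ω v).2 (ω (v.1, v.2 - 1)).2 :=
  rfl

/-! ### Column weights and the transfer matrix -/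

section Column

variable {G₂ : Type*} [AddGroup G₂] [One G₂] [Fintype G₂]

/-- The weight of one column of vertices `{x} × G₂` whose west horizontal arrows are `κ`
(`κ y = true` iff the edge `(x-1, y) — (x, y)` points east), east horizontal arrows `κ'` and
vertical arrows `α` (`α y = true` iff `(x, y) — (x, y+1)` points north).
[cite: DKLM2026SixVertexGFF, Part III §1] -/
def columnWeight (a b c : ℝ) (κ κ' α : G₂ → Bool) : ℝ :=
  ∏ y, localWeight a b c (κ' y) (κ y) (α y) (α (y - 1))

/-- A column configuration of horizontal arrows is **balanced** if half of its arrows point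
east (the set `𝔆`). [cite: DKLM2026SixVertexGFF, Part III §1] -/
def IsBalancedCol (κ : G₂ → Bool) : Prop :=
  2 * (Finset.univ.filter fun y => κ y = true).card = Fintype.card G₂

/-- Balancedness of a column configuration is decidable (an equality of natural numbers); this
makes `{κ // IsBalancedCol κ}` a `Fintype`. [folklore] -/
instance IsBalancedCol.decidable (κ : G₂ → Bool) : Decidable (IsBalancedCol κ) :=
  inferInstanceAs (Decidable (_ = _))

variable [DecidableEq G₂]

/-- **The column transfer matrix** `t(κ, κ') = ∑_α (weight of the column (κ, α, κ'))`
(Cor. 56 (1): at `a = b = 1` the summand is `𝟙{ice rule} c^{#c-vertices}`).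
[cite: DKLM2026SixVertexGFF, Cor. 56 (1)] -/
def transferMatrix (a b c : ℝ) : Matrix (G₂ → Bool) (G₂ → Bool) ℝ :=
  Matrix.of fun κ κ' => ∑ α : G₂ → Bool, columnWeight a b c κ κ' α

/-- **The balanced transfer matrix**: `t` restricted to `𝔆 × 𝔆` (the operator `t(π/2)` on
`Ω = ℓ²(𝔆)`). [cite: DKLM2026SixVertexGFF, Cor. 56 (1)] -/
def balancedTransferMatrix (a b c : ℝ) :
    Matrix {κ : G₂ → Bool // IsBalancedCol κ} {κ : G₂ → Bool // IsBalancedCol κ} ℝ :=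
  (transferMatrix a b c).submatrix Subtype.val Subtype.val

omit [AddGroup G₂] [One G₂] [DecidableEq G₂] in
/-- `IsBalanced` is balancedness of every column of horizontal arrows. [cite: DKLM2026SixVertexGFF, §2.1] -/
theorem isBalanced_iff_forall_isBalancedCol {G₁ : Type*} (ω : Config (G₁ × G₂)) :
    IsBalanced ω ↔ ∀ x : G₁, IsBalancedCol fun y => (ω (x, y)).1 :=
  Iff.rfl

omit [DecidableEq G₂] in
/-- The torus weight is the product of the column weights read off the configuration.
[cite: DKLM2026SixVertexGFF, Lemma 55] -/
theorem torusWeight_eq_prod_columnWeight {G₁ : Type*} [AddGroup G₁] [One G₁] [Fintype G₁]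
    (a b c : ℝ) (ω : Config (G₁ × G₂)) :
    torusWeight a b c ω = ∏ x : G₁,
      columnWeight a b c (fun y => (ω (x - 1, y)).1) (fun y => (ω (x, y)).1) (fun y => (ω (x, y)).2) := by
  unfold torusWeight columnWeight
  rw [Fintype.prod_prod_type]
  rfl

end Column

/-! ### Path expansion of matrix products and the cyclic trace formula -/

section Paths

variable {S R : Type*} [Fintype S] [DecidableEq S] [CommSemiring R]

/-- **Path expansion**: the `(i, j)` entry of `T₀ T₁ ⋯ T_m` is the sum over the intermediate
states `q₁, …, q_m` of `∏_k T_k(v_k, v_{k+1})`, `v = (i, q₁, …, q_m, j)`. [folklore] -/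
theorem listProd_ofFn_apply_eq_sum_paths (m : ℕ) (T : Fin (m + 1) → Matrix S S R) (i j : S) :
    (List.ofFn T).prod i j = ∑ q : Fin m → S, ∏ k : Fin (m + 1),
      T k ((Fin.cons i (Fin.snoc q j : Fin (m + 1) → S) : Fin (m + 2) → S) k.castSucc)
        ((Fin.cons i (Fin.snoc q j : Fin (m + 1) → S) : Fin (m + 2) → S) k.succ) := by
  induction m generalizing j with
  | zero =>
    rw [List.ofFn_succ, List.ofFn_zero, List.prod_cons, List.prod_nil, mul_one,
      Fintype.sum_unique, Fin.prod_univ_one]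
    rfl
  | succ m ih =>
    rw [List.ofFn_succ', List.prod_concat, Matrix.mul_apply]
    simp_rw [ih]
    rw [← (Fin.snocEquiv fun _ => S).sum_comp, Fintype.sum_prod_type]
    refine Finset.sum_congr rfl fun s _ => ?_
    rw [Finset.sum_mul]
    refine Finset.sum_congr rfl fun q _ => ?_
    have e : ((Fin.snocEquiv fun _ => S) (s, q) : Fin (m + 1) → S) = Fin.snoc q s := rfl
    rw [e]
    -- the path `v' = (i, q, s, j)` restricted to its first `m + 2` entries is `v = (i, q, s)`
    have hv : ∀ t : Fin (m + 2),
        ((Fin.cons i (Fin.snoc (Fin.snoc q s : Fin (m + 1) → S) j : Fin (m + 2) → S) :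
            Fin (m + 3) → S) t.castSucc) =
          ((Fin.cons i (Fin.snoc q s : Fin (m + 1) → S) : Fin (m + 2) → S) t) := by
      intro t
      induction t using Fin.cases with
      | zero => rw [Fin.castSucc_zero, Fin.cons_zero, Fin.cons_zero]
      | succ t => rw [Fin.castSucc_succ, Fin.cons_succ, Fin.cons_succ, Fin.snoc_castSucc]
    have hlast : ((Fin.cons i (Fin.snoc (Fin.snoc q s : Fin (m + 1) → S) j : Fin (m + 2) → S) :
        Fin (m + 3) → S) (Fin.last (m + 1)).succ) = j := by
      rw [Fin.cons_succ, Fin.snoc_last]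
    have hvlast : ((Fin.cons i (Fin.snoc q s : Fin (m + 1) → S) : Fin (m + 2) → S)
        (Fin.last (m + 1))) = s := by
      rw [← Fin.succ_last, Fin.cons_succ, Fin.snoc_last]
    show (∏ k : Fin (m + 1), T k.castSucc
        ((Fin.cons i (Fin.snoc q s : Fin (m + 1) → S) : Fin (m + 2) → S) k.castSucc)
        ((Fin.cons i (Fin.snoc q s : Fin (m + 1) → S) : Fin (m + 2) → S) k.succ)) *
        T (Fin.last (m + 1)) s j = _
    conv_rhs => rw [Fin.prod_univ_castSucc]
    congr 1
    · refine Finset.prod_congr rfl fun k _ => ?_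
      rw [hv k.castSucc, ← Fin.castSucc_succ, hv k.succ]
    · rw [hlast, hv, hvlast]

/-- **Cyclic trace formula**: `Trace (T₀ T₁ ⋯ T_m) = ∑_{p : Fin (m+1) → S} ∏_k T_k(p_k, p_{k+1})`
(indices modulo `m + 1`). [folklore] -/
theorem trace_listProd_ofFn_eq_sum_cyclic (m : ℕ) (T : Fin (m + 1) → Matrix S S R) :
    Matrix.trace (List.ofFn T).prod =
      ∑ p : Fin (m + 1) → S, ∏ k : Fin (m + 1), T k (p k) (p (k + 1)) := by
  rw [Matrix.trace]
  simp only [Matrix.diag_apply, listProd_ofFn_apply_eq_sum_paths]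
  rw [← (Fin.consEquiv fun _ => S).sum_comp, Fintype.sum_prod_type]
  refine Finset.sum_congr rfl fun i _ => Finset.sum_congr rfl fun q _ => ?_
  refine Finset.prod_congr rfl fun k _ => ?_
  show T k ((Fin.cons i (Fin.snoc q i : Fin (m + 1) → S) : Fin (m + 2) → S) k.castSucc)
      ((Fin.cons i (Fin.snoc q i : Fin (m + 1) → S) : Fin (m + 2) → S) k.succ) =
    T k ((Fin.cons i q : Fin (m + 1) → S) k) ((Fin.cons i q : Fin (m + 1) → S) (k + 1))
  congr 1
  · induction k using Fin.cases with
    | zero => rw [Fin.castSucc_zero, Fin.cons_zero, Fin.cons_zero]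
    | succ t => rw [Fin.castSucc_succ, Fin.cons_succ, Fin.cons_succ, Fin.snoc_castSucc]
  · induction k using Fin.lastCases with
    | last => rw [Fin.last_add_one, Fin.cons_zero, Fin.cons_succ, Fin.snoc_last]
    | cast t => rw [Fin.coeSucc_eq_succ, Fin.cons_succ, Fin.cons_succ, Fin.snoc_castSucc]

/-- **Cyclic trace formula for powers**: `Trace (T^{m+1}) = ∑_{p : Fin (m+1) → S} ∏_k T(p_k, p_{k+1})`.
[folklore] -/
theorem trace_pow_eq_sum_cyclic (m : ℕ) (T : Matrix S S R) :
    Matrix.trace (T ^ (m + 1)) = ∑ p : Fin (m + 1) → S, ∏ k : Fin (m + 1), T (p k) (p (k + 1)) := by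
  rw [← trace_listProd_ofFn_eq_sum_cyclic m fun _ => T, List.ofFn_const, List.prod_replicate]

end Paths

/-! ### Torus partition functions as traces (Cor. 56 (3) with `X = 1`) -/

section TorusTrace

variable {G₂ : Type*} [AddGroup G₂] [One G₂] [Fintype G₂] [DecidableEq G₂]

/-- Splitting a configuration on `G₁ × G₂` into its horizontal and vertical arrows, column by
column. [folklore] -/
def columnSplit (G₁ : Type*) (G₂ : Type*) :
    Config (G₁ × G₂) ≃ (G₁ → G₂ → Bool) × (G₁ → G₂ → Bool) where
  toFun ω := (fun x y => (ω (x, y)).1, fun x y => (ω (x, y)).2)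
  invFun κα v := (κα.1 v.1 v.2, κα.2 v.1 v.2)
  left_inv ω := by
    funext v
    simp
  right_inv κα := by
    rcases κα with ⟨κ, α⟩
    rfl

/-- Summing the column weights over all vertical arrows gives the product of transfer-matrix
entries along the cyclic sequence of horizontal column configurations.
[cite: DKLM2026SixVertexGFF, Lemma 55 and Cor. 56] -/
theorem sum_prod_columnWeight_eq_prod_transferMatrix {G₁ : Type*} [AddGroup G₁] [One G₁]
    [Fintype G₁] [DecidableEq G₁] (a b c : ℝ) (κ : G₁ → G₂ → Bool) :
    ∑ α : G₁ → G₂ → Bool, ∏ x : G₁, columnWeight a b c (κ (x - 1)) (κ x) (α x) =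
      ∏ x : G₁, transferMatrix a b c (κ (x - 1)) (κ x) := by
  simp only [transferMatrix, Matrix.of_apply]
  rw [Finset.prod_univ_sum, Fintype.piFinset_univ]

/-- **The torus partition function is a trace**: `Z_{𝕋_{M, G₂}} = ∑_ω W(ω) = Trace (t^M)` for
the torus `ZMod M × G₂`, `M = m + 1`. [cite: DKLM2026SixVertexGFF, Cor. 56 (3)] -/
theorem sum_torusWeight_eq_trace (a b c : ℝ) (m : ℕ) :
    ∑ ω : Config (ZMod (m + 1) × G₂), torusWeight a b c ω =
      Matrix.trace (transferMatrix (G₂ := G₂) a b c ^ (m + 1)) := by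
  rw [trace_pow_eq_sum_cyclic, ← (columnSplit (ZMod (m + 1)) G₂).symm.sum_comp,
    Fintype.sum_prod_type]
  refine Finset.sum_congr rfl fun κ _ => ?_
  have h1 : ∀ α : ZMod (m + 1) → G₂ → Bool,
      torusWeight a b c ((columnSplit (ZMod (m + 1)) G₂).symm (κ, α)) =
        ∏ x : ZMod (m + 1), columnWeight a b c (κ (x - 1)) (κ x) (α x) :=
    fun α => torusWeight_eq_prod_columnWeight a b c _
  simp only [h1]
  rw [sum_prod_columnWeight_eq_prod_transferMatrix]
  exact (Fintype.prod_equiv (Equiv.addRight (1 : ZMod (m + 1))) _ _ fun k => by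
    simp only [Equiv.coe_addRight, add_sub_cancel_right]; rfl).symm

open scoped Classical in
/-- **The balanced torus partition function is a trace** (Cor. 56 (3) with `X = 1`):
`∑_{ω balanced} W(ω) = Trace (t_𝔆^M)` on the torus `ZMod M × G₂`, `M = m + 1`, where `t_𝔆` is the
transfer matrix restricted to balanced column configurations. [cite: DKLM2026SixVertexGFF, Cor. 56 (3)] -/
theorem sum_torusWeight_filter_isBalanced_eq_trace (a b c : ℝ) (m : ℕ) :
    ∑ ω ∈ Finset.univ.filter (fun ω : Config (ZMod (m + 1) × G₂) => IsBalanced ω),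
        torusWeight a b c ω =
      Matrix.trace (balancedTransferMatrix (G₂ := G₂) a b c ^ (m + 1)) := by
  classical
  rw [trace_pow_eq_sum_cyclic]
  -- pass to the sum over all configurations of `𝟙{balanced} W`
  rw [Finset.sum_filter, ← (columnSplit (ZMod (m + 1)) G₂).symm.sum_comp, Fintype.sum_prod_type]
  have h1 : ∀ (κ α : ZMod (m + 1) → G₂ → Bool),
      torusWeight a b c ((columnSplit (ZMod (m + 1)) G₂).symm (κ, α)) =
        ∏ x : ZMod (m + 1), columnWeight a b c (κ (x - 1)) (κ x) (α x) :=
    fun κ α => torusWeight_eq_prod_columnWeight a b c _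
  have h2 : ∀ (κ α : ZMod (m + 1) → G₂ → Bool),
      IsBalanced ((columnSplit (ZMod (m + 1)) G₂).symm (κ, α)) ↔ ∀ x, IsBalancedCol (κ x) :=
    fun κ α => Iff.rfl
  simp only [h1, h2]
  -- the indicator does not depend on `α`: sum `α` out
  have h3 : ∀ κ : ZMod (m + 1) → G₂ → Bool,
      (∑ α : ZMod (m + 1) → G₂ → Bool, if ∀ x, IsBalancedCol (κ x) then
          ∏ x : ZMod (m + 1), columnWeight a b c (κ (x - 1)) (κ x) (α x) else 0) =
        if ∀ x, IsBalancedCol (κ x) then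
          ∏ x : ZMod (m + 1), transferMatrix a b c (κ (x - 1)) (κ x) else 0 := by
    intro κ
    split_ifs with h
    · exact sum_prod_columnWeight_eq_prod_transferMatrix a b c κ
    · simp
  simp only [h3]
  -- restrict to the subtype of everywhere-balanced `κ`, then to `ZMod (m+1) → 𝔆`
  rw [← Finset.sum_filter,
    Finset.sum_subtype (Finset.univ.filter fun κ : ZMod (m + 1) → G₂ → Bool => ∀ x, IsBalancedCol (κ x))
      (p := fun κ : ZMod (m + 1) → G₂ → Bool => ∀ x, IsBalancedCol (κ x)) (by simp),
    ← (Equiv.subtypePiEquivPi (β := fun _ : ZMod (m + 1) => G₂ → Bool)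
      (p := fun _ κ => IsBalancedCol κ)).symm.sum_comp]
  refine Finset.sum_congr rfl fun p _ => ?_
  simp only [balancedTransferMatrix, Matrix.submatrix_apply]
  exact (Fintype.prod_equiv (Equiv.addRight (1 : ZMod (m + 1))) _ _ fun k => by
    simp only [Equiv.coe_addRight, add_sub_cancel_right]; rfl).symm

end TorusTrace

end Literature.Probability.LatticeModels.SixVertex

end
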